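import Literature.Claims.NS.Nwankpa2025
import Summits.NavierStokesRegularity.NavierStokesRegularity.Theorems.SoloRefuteChishtie2025
import HarnessLib

/-!
# C93 `Nwankpa2025` — refutation certificate at the print's own proof grain (A14)

Text of record: A. Nwankpa, «The Logic of Fluids: Coherence and Regularity in the Navier–Stokes System»,
Preprints.org 202506.2259 v4 (2025), print p.N = PDF p.N+1. Skeleton `Literature.Claims.NS.Nwankpa2025`
(typist-6 g2, p485598): `claim_of_steps : Step5_UniformL3 → Step6_ESSBridge → ClaimedTheorem`, with
Steps 1–4 the printed derivation of Step 5; the decisive display is Lemma 1 Step 3, (10) p.7 («multiplying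
the momentum equation by |u|u and integrating yields … (10). The pressure term vanishes by
incompressibility. The constant C > 0 depends only on dimension.»), whose printed justification is
Appendix G.2 (A14) p.13 («This estimate is rigorously justified for smooth divergence-free functions»),
typed at the print's own FUNCTIONS grain as `Step3b_A14` (no equation imposed on the fields, App. G.1).

This file is typist-6 g2's kernel kit (claims/Nwankpa2025/SoloRefuteNwankpa2025.draft.lean, sha16
38f1f3b4f3814e4b; grain observation typist-4 g2), adopted by the refuter of record (refuter-3) with
docstrings added and no change of content:

* `not_Step3b_A14 : ¬ Step3b_A14` — for `u(t, x) = e^{λt} w(x)`, `w` the smooth compactly supported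
  divergence-free bump `Chishtie2025.datum` (`w(0) = e₀`), `d/dt ‖u‖³_{L³}|_{t=0} = 3λK`,
  `K = ‖w‖³_{L³} > 0`, while the right side of (A14) at `t = 0` is a `λ`-free number and the
  dissipative term is `≥ 0`: `λ = R/(3K) + 1` contradicts (A14) for every constant `C`.

At the SOLUTIONS grain ((10), `Step3_L3Inequality`) no kernel is offered: no non-trivial global smooth
solution with Clay data is explicit in the tree; there the display is an unfilled gap (no derivation; a
dimension-only `C` is scaling-inconsistent, λ² vs λ¹ under `u_λ = λu(λx, λ²t)`; the pressure pairing
`∫ ∇p · |u|u = −∫ p u·∇|u|` does not vanish) — referee ref-1 g2 RETYPE.md §0–§2.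

WHAT THIS IS NOT: not a claim about NS regularity or blow-up; not a claim about any author beyond the
typed locator.
-/

-- the cell's Theorems namespace repeats the summit name (convention); silence the duplicate-namespace linter
set_option linter.dupNamespace false

open scoped ContDiff
open Set MeasureTheory
open Literature.Analysis.FluidPDE Literature.Claims.NS.Nwankpa2025
open Summit.NavierStokesRegularity.NavierStokesRegularity.Theorems.Chishtie2025
  (datum contDiff_datum hasCompactSupport_datum isDivFree_datum datum_zero)

namespace Summit.NavierStokesRegularity.NavierStokesRegularity.Theorems.Nwankpa2025

/-- The test field `u(t, x) = e^{λt} · w(x)`, `w = Chishtie2025.datum` (a smooth, compactly supported,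
divergence-free bump with `w(0) = e₀`). [folklore] -/
noncomputable def uexp (lam : ℝ) (t : ℝ) (x : E3) : E3 := Real.exp (lam * t) • datum x

/-- `K = ‖w‖³_{L³} = ∫ ‖datum x‖³ dx`. [folklore] -/
noncomputable def K : ℝ := ∫ x : E3, ‖datum x‖ ^ 3

/-- `K > 0` (`w` is continuous, compactly supported, and `w(0) ≠ 0`). [folklore] -/
theorem K_pos : 0 < K := by
  unfold K
  have hc : Continuous fun x : E3 => ‖datum x‖ ^ 3 := (contDiff_datum.continuous.norm).pow 3
  have hs : HasCompactSupport fun x : E3 => ‖datum x‖ ^ 3 :=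
    hasCompactSupport_datum.norm.comp_left (g := fun r : ℝ => r ^ 3) (by simp)
  refine hc.integral_pos_of_hasCompactSupport_nonneg_nonzero hs (fun x => by positivity) (x := 0) ?_
  rw [datum_zero]
  simp [Literature.Claims.NS.Chishtie2025.e]

/-- `u` is jointly smooth. [folklore] -/
theorem uexp_smooth (lam : ℝ) : ContDiff ℝ ∞ (Function.uncurry (uexp lam)) := by
  have h : Function.uncurry (uexp lam) = fun q : ℝ × E3 => Real.exp (lam * q.1) • datum q.2 := by
    funext q; rfl
  rw [h]
  exact (Real.contDiff_exp.comp (contDiff_const.mul contDiff_fst)).smul (contDiff_datum.comp contDiff_snd)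

/-- Each slice `u(t, ·)` is divergence free. [folklore] -/
theorem uexp_divFree (lam t : ℝ) : NSWave0.IsDivFree (uexp lam t) := by
  intro x
  unfold NSWave0.divergence
  have hd : DifferentiableAt ℝ datum x := (contDiff_datum.differentiable (by simp)).differentiableAt
  have h1 : uexp lam t = Real.exp (lam * t) • datum := rfl
  rw [h1, fderiv_const_smul hd, ContinuousLinearMap.toLinearMap_smul, map_smul]
  have h0 := isDivFree_datum x
  unfold NSWave0.divergence at h0
  rw [h0, smul_zero]

/-- Each slice `u(t, ·)` is compactly supported. [folklore] -/
theorem uexp_compactSupport (lam t : ℝ) : HasCompactSupport (uexp lam t) :=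
  hasCompactSupport_datum.smul_left (f := fun _ : E3 => Real.exp (lam * t))

/-- `u(0, ·) = w`. [folklore] -/
theorem uexp_zero (lam : ℝ) : uexp lam 0 = datum := by
  funext x; simp [uexp]

/-- `‖u(s)‖³_{L³} = e^{3λs} K`. [folklore] -/
theorem l3cube_uexp (lam : ℝ) : l3cube (uexp lam) = fun s => Real.exp (3 * lam * s) * K := by
  funext s
  unfold l3cube uexp K
  rw [← integral_const_mul]
  congr 1
  funext x
  rw [norm_smul, Real.norm_eq_abs, abs_of_pos (Real.exp_pos _), mul_pow, ← Real.exp_nat_mul]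
  congr 2
  push_cast
  ring

/-- `d/ds ‖u(s)‖³_{L³}|_{s=0} = 3λK`. [folklore] -/
theorem hasDerivAt_l3cube_uexp_zero (lam : ℝ) : HasDerivAt (l3cube (uexp lam)) (3 * lam * K) 0 := by
  rw [l3cube_uexp]
  have h1 : HasDerivAt (fun s : ℝ => 3 * lam * s) (3 * lam) 0 := by
    simpa using (hasDerivAt_id' (0 : ℝ)).const_mul (3 * lam)
  have h2 := h1.exp.mul_const K
  simpa using h2

/-- The dissipative term `∫ |u| |∇u|²` is non-negative. [folklore] -/
theorem mixed_nonneg (u : ℝ → E3 → E3) (t : ℝ) : 0 ≤ mixed u t :=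
  integral_nonneg fun x => by positivity

/-- **(A14) App. G.2 p.13 (functions grain, `Step3b_A14`) is kernel-false:** for `u = e^{λt}·datum`,
`d/dt‖u‖³_{L³}|_{t=0} = 3λK` with `K = ‖datum‖³_{L³} > 0`, while the right side at `t = 0` is the `λ`-free
number `C K^{2/3} ‖∇datum‖²_{L²}` and the dissipative term is `≥ 0`; `λ` large contradicts (A14).
CLASS (typist's reading; refuter/referee decide): false lemma (countermodel) at the print's own second
grain of the decisive Step 3; the solutions-grain display (10) p.7 is the same inequality asserted for
solutions (no derivation printed; scaling-inconsistent — CARD §5).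
[cite: Nwankpa2025, Appendix G.2 (A14) p.13; Lemma 1 Step 3 (10) p.7] -/
theorem not_Step3b_A14 : ¬ Step3b_A14 := by
  rintro ⟨C, -, h⟩
  set R : ℝ := C * (l3cube (uexp 0) 0) ^ (2 / 3 : ℝ) * gradsq (uexp 0) 0 with hR
  set lam : ℝ := R / (3 * K) + 1 with hlam
  have hK := K_pos
  have key := h 1 (uexp lam) one_pos (uexp_smooth lam) (uexp_divFree lam) (uexp_compactSupport lam)
    0 (3 * lam * K) (hasDerivAt_l3cube_uexp_zero lam)
  -- the right side and the slices at `t = 0` do not depend on `lam`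
  have h0 : uexp lam 0 = uexp 0 0 := by rw [uexp_zero, uexp_zero]
  have hl3 : l3cube (uexp lam) 0 = l3cube (uexp 0) 0 := by unfold l3cube; rw [h0]
  have hgr : gradsq (uexp lam) 0 = gradsq (uexp 0) 0 := by unfold gradsq; rw [h0]
  rw [hl3, hgr, ← hR] at key
  have hmix := mixed_nonneg (uexp lam) 0
  have h3 : 3 * lam * K ≤ R := by linarith
  have h4 : 3 * lam * K = R + 3 * K := by
    rw [hlam]; field_simp
  linarith

end Summit.NavierStokesRegularity.NavierStokesRegularity.Theorems.Nwankpa2025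

-- WHAT THIS IS NOT: not a claim about NS regularity or blow-up; not a claim about any author beyond the typed locator.
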